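import Mathlib.MeasureTheory.Group.FundamentalDomain
import Mathlib.MeasureTheory.Integral.Bochner.Set
import HarnessLib

/-!
# Lattice sums versus integrals: the cell decomposition over a fundamental domain and the
# oscillation bound `‖Σ_{γ} a(γ) − ν(𝓕)⁻¹ ∫ φ dν‖ ≤ ε · ν(B) / ν(𝓕)`

Topic `MeasureTheory/Group`; namespace `Literature.MeasureTheory.Group`. KERNEL only (Mathlib-only
imports): proved theorems, no definition, no named fact, no instance, no `sorry`.

Let a countable group `Γ` act measurably on a measurable space `α` preserving a measure `ν`
(Mathlib's `MeasureTheory.IsFundamentalDomain` setting: `[MeasurableConstSMul Γ α]`,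
`[SMulInvariantMeasure Γ α ν]`), and let `𝓕` be a fundamental domain of finite non-zero measure.
For an integrable `φ : α → V` whose cells `γ • 𝓕` carrying a non-zero value of `φ` are indexed by a
finite set `R ⊆ Γ`, and for ANY family of «sample values» `a : Γ → V` (typically `a γ = φ(γ • x₀)`,
the value of `φ` at the lattice point of the cell), we PROVE the exact **cell decomposition**
  `Σ_{γ ∈ R} a(γ) − ν(𝓕)⁻¹ ∫_α φ dν = ν(𝓕)⁻¹ Σ_{γ ∈ R} ∫_𝓕 (a(γ) − φ(γ • u)) dν(u)`
(`sum_sub_smul_integral_eq`; the integral unfolds as `Σ_γ ∫_𝓕 φ(γ • u) dν(u)` by Mathlib's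
`IsFundamentalDomain.integral_eq_tsum''`, and `a(γ) = ν(𝓕)⁻¹ ∫_𝓕 a(γ) dν`), whence the
**oscillation bound**: if `‖a(γ) − φ(γ • u)‖ ≤ ε` for all `γ ∈ R`, `u ∈ 𝓕` then
  `‖Σ_{γ ∈ R} a(γ) − ν(𝓕)⁻¹ ∫ φ dν‖ ≤ |R| · ε`           (`norm_sum_sub_smul_integral_le`),
and the **cell count** `|R| · ν(𝓕) ≤ ν(B)` for any set `B` containing the cells `γ • 𝓕`, `γ ∈ R`
(`card_mul_measure_le_of_smul_subset`: the translates of a fundamental domain are a.e. disjoint of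
equal measure), so that `‖Σ_{γ ∈ R} a(γ) − ν(𝓕)⁻¹ ∫ φ dν‖ ≤ ε · ν(B) / ν(𝓕)`
(`norm_sum_sub_smul_integral_le_of_smul_subset`); `tsum` forms for finitely supported `a`
(`tsum_sub_smul_integral_eq`, `norm_tsum_sub_smul_integral_le_of_smul_subset`).

This is the elementary «Riemann sum» comparison of a lattice sum with the corresponding integral
(each lattice point is charged with the oscillation of the function over its cell; the number of
charged cells is controlled by the measure they fill), the physical-side alternative to Poisson
summation when only ONE power of the mesh is needed — e.g. for the difference
`Σ_{n ∈ N(F)} f(g⁻¹ γ n g) − ∫_{N(𝔸)} f(g⁻¹ γ n g) dn` of the truncated kernel of the trace formula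
high in the cusp ([Gelbart1975, §9.B, (9.44)–(9.46)] obtains the decay by Poisson summation; one
power of the root suffices for integrability in `F`-rank one). The cell argument is the one of
[Weil1965, Chap. I n° 12, proof of Lemme 5, pp. 21–22] (cf. the tree's `LatticeSumDilationBound`,
which bounds `Σ_{ξ ∈ L} g(ξ/T)` by the same tiling); the statements here are for an arbitrary
measure-preserving action with a fundamental domain (left translation by a discrete subgroup of a
unimodular group being the use case). Folklore.

## References

* [Weil1965] A. Weil, *Sur la formule de Siegel dans la théorie des groupes classiques*, Acta Math.
  113 (1965), Chap. I n° 12, proof of Lemme 5, pp. 21–22.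
* [Gelbart1975] S. Gelbart, *Automorphic forms on adele groups*, Ann. of Math. Studies 83 (1975),
  §9.B, (9.44)–(9.46).
-/

set_option autoImplicit false

noncomputable section

open MeasureTheory Set Filter
open scoped ENNReal NNReal Pointwise BigOperators

namespace Literature.MeasureTheory.Group

variable {Γ α : Type*} [Group Γ] [MulAction Γ α] [MeasurableSpace α] [MeasurableConstSMul Γ α]
  [Countable Γ] {ν : Measure α} [SMulInvariantMeasure Γ α ν]
  {V : Type*} [NormedAddCommGroup V] [NormedSpace ℝ V] [CompleteSpace V]
  {𝓕 : Set α} {φ : α → V}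

/-! ## §1 The cell decomposition of the integral -/

omit [CompleteSpace V] in
/-- The cells carrying `φ`: if `φ` vanishes on `γ • 𝓕` for `γ ∉ R` — in the form used below,
`φ (γ • u) = 0` for `u ∈ 𝓕` — then the unfolded integral is a finite sum:
**`∫_α φ dν = Σ_{γ ∈ R} ∫_𝓕 φ(γ • u) dν(u)`** (Mathlib `IsFundamentalDomain.integral_eq_tsum''`).
[cite: Weil1965, Chap. I n° 12, proof of Lemme 5 (pp. 21–22)] -/
theorem integral_eq_sum_setIntegral_smul (h𝓕 : IsFundamentalDomain Γ 𝓕 ν) (hφ : Integrable φ ν)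
    (R : Finset Γ) (hR : ∀ γ ∉ R, ∀ u ∈ 𝓕, φ (γ • u) = 0) :
    ∫ x, φ x ∂ν = ∑ γ ∈ R, ∫ u in 𝓕, φ (γ • u) ∂ν := by
  rw [h𝓕.integral_eq_tsum'' φ hφ]
  exact tsum_eq_sum fun γ hγ => setIntegral_eq_zero_of_forall_eq_zero (hR γ hγ)

omit [MeasurableSpace α] [MeasurableConstSMul Γ α] [Countable Γ] [NormedSpace ℝ V] [CompleteSpace V] in
/-- A sufficient condition for the finiteness hypothesis: `φ` is supported in `S` and the cells
`γ • 𝓕`, `γ ∉ R`, do not meet `S`. [cite: Weil1965, Chap. I n° 12, proof of Lemme 5 (pp. 21–22)] -/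
theorem forall_smul_eq_zero_of_disjoint {S : Set α} (hS : Function.support φ ⊆ S) (R : Finset Γ)
    (hR : ∀ γ ∉ R, Disjoint (γ • 𝓕) S) : ∀ γ ∉ R, ∀ u ∈ 𝓕, φ (γ • u) = 0 := by
  intro γ hγ u hu
  by_contra h
  exact Set.disjoint_left.1 (hR γ hγ) (Set.smul_mem_smul_set hu) (hS h)

omit [Countable Γ] [NormedSpace ℝ V] [CompleteSpace V] in
/-- Each unfolded term is integrable: `u ↦ φ(γ • u)` is integrable on `𝓕` (the action preserves
`ν`). [cite: Weil1965, Chap. I n° 12, proof of Lemme 5 (pp. 21–22)] -/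
theorem integrableOn_comp_smul (hφ : Integrable φ ν) (γ : Γ) (s : Set α) :
    IntegrableOn (fun u => φ (γ • u)) s ν := by
  have h : Integrable (φ ∘ fun u : α => γ • u) ν :=
    ((measurePreserving_smul γ ν).integrable_comp_emb (measurableEmbedding_const_smul γ)).2 hφ
  exact h.integrableOn

/-! ## §2 The identity `Σ a(γ) − ν(𝓕)⁻¹ ∫ φ = ν(𝓕)⁻¹ Σ ∫_𝓕 (a(γ) − φ(γ • u))` -/

omit [Countable Γ] in
/-- One cell: `∫_𝓕 (a − φ(γ • u)) dν(u) = ν(𝓕) • a − ∫_𝓕 φ(γ • u) dν(u)`. [cite: Weil1965, Chap. I n° 12, proof of Lemme 5 (pp. 21–22)] -/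
theorem setIntegral_const_sub_comp_smul (hφ : Integrable φ ν) (htop : ν 𝓕 ≠ ∞) (a : V) (γ : Γ) :
    ∫ u in 𝓕, (a - φ (γ • u)) ∂ν = (ν 𝓕).toReal • a - ∫ u in 𝓕, φ (γ • u) ∂ν := by
  have hc : IntegrableOn (fun _ : α => a) 𝓕 ν := integrableOn_const htop
  rw [integral_sub hc (integrableOn_comp_smul hφ γ 𝓕), setIntegral_const]
  rfl

/-- **THE CELL DECOMPOSITION.** For a fundamental domain `𝓕` of finite non-zero measure, an
integrable `φ` carried by the cells `γ • 𝓕`, `γ ∈ R`, and any sample values `a : Γ → V`: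
`Σ_{γ ∈ R} a(γ) − ν(𝓕)⁻¹ ∫ φ dν = ν(𝓕)⁻¹ Σ_{γ ∈ R} ∫_𝓕 (a(γ) − φ(γ • u)) dν(u)`.
[cite: Weil1965, Chap. I n° 12, proof of Lemme 5 (pp. 21–22)] -/
theorem sum_sub_smul_integral_eq (h𝓕 : IsFundamentalDomain Γ 𝓕 ν) (hφ : Integrable φ ν)
    (h0 : ν 𝓕 ≠ 0) (htop : ν 𝓕 ≠ ∞) (R : Finset Γ) (hR : ∀ γ ∉ R, ∀ u ∈ 𝓕, φ (γ • u) = 0)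
    (a : Γ → V) :
    ∑ γ ∈ R, a γ - (ν 𝓕).toReal⁻¹ • ∫ x, φ x ∂ν =
      (ν 𝓕).toReal⁻¹ • ∑ γ ∈ R, ∫ u in 𝓕, (a γ - φ (γ • u)) ∂ν := by
  have hr : (ν 𝓕).toReal ≠ 0 := ENNReal.toReal_ne_zero.2 ⟨h0, htop⟩
  simp_rw [setIntegral_const_sub_comp_smul hφ htop]
  rw [Finset.sum_sub_distrib, ← Finset.smul_sum, ← integral_eq_sum_setIntegral_smul h𝓕 hφ R hR,
    smul_sub, smul_smul, inv_mul_cancel₀ hr, one_smul]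

/-- `tsum` form: if moreover `a` vanishes off `R`, then
`Σ'_{γ ∈ Γ} a(γ) − ν(𝓕)⁻¹ ∫ φ dν = ν(𝓕)⁻¹ Σ_{γ ∈ R} ∫_𝓕 (a(γ) − φ(γ • u)) dν(u)`.
[cite: Weil1965, Chap. I n° 12, proof of Lemme 5 (pp. 21–22)] -/
theorem tsum_sub_smul_integral_eq (h𝓕 : IsFundamentalDomain Γ 𝓕 ν) (hφ : Integrable φ ν)
    (h0 : ν 𝓕 ≠ 0) (htop : ν 𝓕 ≠ ∞) (R : Finset Γ) (hR : ∀ γ ∉ R, ∀ u ∈ 𝓕, φ (γ • u) = 0)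
    {a : Γ → V} (ha : ∀ γ ∉ R, a γ = 0) :
    ∑' γ, a γ - (ν 𝓕).toReal⁻¹ • ∫ x, φ x ∂ν =
      (ν 𝓕).toReal⁻¹ • ∑ γ ∈ R, ∫ u in 𝓕, (a γ - φ (γ • u)) ∂ν := by
  rw [tsum_eq_sum ha]
  exact sum_sub_smul_integral_eq h𝓕 hφ h0 htop R hR a

/-! ## §3 The oscillation bound -/

omit [MeasurableConstSMul Γ α] [Countable Γ] [SMulInvariantMeasure Γ α ν] [CompleteSpace V] in
/-- One cell: if `‖a − φ(γ • u)‖ ≤ ε` on `𝓕` then `‖∫_𝓕 (a − φ(γ • u)) dν(u)‖ ≤ ε · ν(𝓕)`.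
[cite: Weil1965, Chap. I n° 12, proof of Lemme 5 (pp. 21–22)] -/
theorem norm_setIntegral_const_sub_comp_smul_le (htop : ν 𝓕 ≠ ∞) {a : V} {γ : Γ} {ε : ℝ}
    (hosc : ∀ u ∈ 𝓕, ‖a - φ (γ • u)‖ ≤ ε) :
    ‖∫ u in 𝓕, (a - φ (γ • u)) ∂ν‖ ≤ ε * (ν 𝓕).toReal :=
  norm_setIntegral_le_of_norm_le_const htop.lt_top hosc

/-- **THE OSCILLATION BOUND.** If `‖a(γ) − φ(γ • u)‖ ≤ ε` for all `γ ∈ R` and `u ∈ 𝓕` (the value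
sampled at the lattice point differs from the values on its cell by at most `ε`), then
`‖Σ_{γ ∈ R} a(γ) − ν(𝓕)⁻¹ ∫ φ dν‖ ≤ |R| · ε`.
[cite: Weil1965, Chap. I n° 12, proof of Lemme 5 (pp. 21–22)] -/
theorem norm_sum_sub_smul_integral_le (h𝓕 : IsFundamentalDomain Γ 𝓕 ν) (hφ : Integrable φ ν)
    (h0 : ν 𝓕 ≠ 0) (htop : ν 𝓕 ≠ ∞) (R : Finset Γ) (hR : ∀ γ ∉ R, ∀ u ∈ 𝓕, φ (γ • u) = 0)
    (a : Γ → V) {ε : ℝ} (hosc : ∀ γ ∈ R, ∀ u ∈ 𝓕, ‖a γ - φ (γ • u)‖ ≤ ε) :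
    ‖∑ γ ∈ R, a γ - (ν 𝓕).toReal⁻¹ • ∫ x, φ x ∂ν‖ ≤ R.card * ε := by
  have hpos : 0 < (ν 𝓕).toReal := ENNReal.toReal_pos h0 htop
  rw [sum_sub_smul_integral_eq h𝓕 hφ h0 htop R hR a, norm_smul, norm_inv, Real.norm_eq_abs,
    abs_of_pos hpos]
  calc (ν 𝓕).toReal⁻¹ * ‖∑ γ ∈ R, ∫ u in 𝓕, (a γ - φ (γ • u)) ∂ν‖
      ≤ (ν 𝓕).toReal⁻¹ * ∑ γ ∈ R, ‖∫ u in 𝓕, (a γ - φ (γ • u)) ∂ν‖ :=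
        mul_le_mul_of_nonneg_left (norm_sum_le _ _) (inv_nonneg.2 hpos.le)
    _ ≤ (ν 𝓕).toReal⁻¹ * ∑ γ ∈ R, ε * (ν 𝓕).toReal :=
        mul_le_mul_of_nonneg_left (Finset.sum_le_sum fun γ hγ =>
          norm_setIntegral_const_sub_comp_smul_le htop (hosc γ hγ)) (inv_nonneg.2 hpos.le)
    _ = R.card * ε := by
        rw [Finset.sum_const, nsmul_eq_mul]
        field_simp

/-! ## §4 Counting the cells by the measure they fill -/

omit [Countable Γ] in
/-- **CELL COUNT.** The translates `γ • 𝓕` of a fundamental domain are a.e. disjoint and of equal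
measure, so finitely many of them contained in `B` number at most `ν(B) / ν(𝓕)`:
`|R| · ν(𝓕) ≤ ν(B)` whenever `γ • 𝓕 ⊆ B` for all `γ ∈ R`. [cite: Weil1965, Chap. I n° 12, proof of Lemme 5 (pp. 21–22)] -/
theorem card_mul_measure_le_of_smul_subset (h𝓕 : IsFundamentalDomain Γ 𝓕 ν) (R : Finset Γ)
    {B : Set α} (hB : ∀ γ ∈ R, γ • 𝓕 ⊆ B) : (R.card : ℝ≥0∞) * ν 𝓕 ≤ ν B := by
  have hdisj : Set.Pairwise (↑R : Set Γ) (fun γ₁ γ₂ : Γ => AEDisjoint ν (γ₁ • 𝓕) (γ₂ • 𝓕)) :=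
    h𝓕.aedisjoint.set_pairwise _
  calc (R.card : ℝ≥0∞) * ν 𝓕 = ∑ γ ∈ R, ν (γ • 𝓕) := by
        simp_rw [measure_smul, Finset.sum_const, nsmul_eq_mul]
    _ = ν (⋃ γ ∈ R, γ • 𝓕) :=
        (measure_biUnion_finset₀ hdisj fun γ _ => h𝓕.nullMeasurableSet_smul γ).symm
    _ ≤ ν B := measure_mono (Set.iUnion₂_subset hB)

omit [Countable Γ] in
/-- Real form of the cell count: `|R| ≤ ν(B) / ν(𝓕)` for `ν(𝓕) ≠ 0` and `ν(B) < ∞`. [cite: Weil1965, Chap. I n° 12, proof of Lemme 5 (pp. 21–22)] -/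
theorem card_le_measureReal_div (h𝓕 : IsFundamentalDomain Γ 𝓕 ν) (h0 : ν 𝓕 ≠ 0)
    (htop : ν 𝓕 ≠ ∞) (R : Finset Γ) {B : Set α} (hB : ∀ γ ∈ R, γ • 𝓕 ⊆ B) (hBtop : ν B ≠ ∞) :
    (R.card : ℝ) ≤ (ν B).toReal / (ν 𝓕).toReal := by
  have hpos : 0 < (ν 𝓕).toReal := ENNReal.toReal_pos h0 htop
  rw [le_div_iff₀ hpos]
  have h := card_mul_measure_le_of_smul_subset h𝓕 R hB
  have h' : ((R.card : ℝ≥0∞) * ν 𝓕).toReal ≤ (ν B).toReal := ENNReal.toReal_mono hBtop h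
  rwa [ENNReal.toReal_mul, ENNReal.toReal_natCast] at h'

/-! ## §5 The packaged estimate -/

/-- **LATTICE SUM VERSUS INTEGRAL.** Let `𝓕` be a fundamental domain of finite non-zero measure
for a measure-preserving action of a countable group `Γ`, `φ` integrable and carried by the cells
`γ • 𝓕`, `γ ∈ R`, all contained in a set `B` of finite measure, and suppose the sample values
satisfy `‖a(γ) − φ(γ • u)‖ ≤ ε` (`γ ∈ R`, `u ∈ 𝓕`) with `ε ≥ 0`. Then
`‖Σ_{γ ∈ R} a(γ) − ν(𝓕)⁻¹ ∫ φ dν‖ ≤ ε · ν(B) / ν(𝓕)`.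
[cite: Weil1965, Chap. I n° 12, proof of Lemme 5 (pp. 21–22)] -/
theorem norm_sum_sub_smul_integral_le_of_smul_subset (h𝓕 : IsFundamentalDomain Γ 𝓕 ν)
    (hφ : Integrable φ ν) (h0 : ν 𝓕 ≠ 0) (htop : ν 𝓕 ≠ ∞) (R : Finset Γ)
    (hR : ∀ γ ∉ R, ∀ u ∈ 𝓕, φ (γ • u) = 0) (a : Γ → V) {ε : ℝ} (hε : 0 ≤ ε)
    (hosc : ∀ γ ∈ R, ∀ u ∈ 𝓕, ‖a γ - φ (γ • u)‖ ≤ ε) {B : Set α} (hB : ∀ γ ∈ R, γ • 𝓕 ⊆ B)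
    (hBtop : ν B ≠ ∞) :
    ‖∑ γ ∈ R, a γ - (ν 𝓕).toReal⁻¹ • ∫ x, φ x ∂ν‖ ≤ ε * ((ν B).toReal / (ν 𝓕).toReal) :=
  calc ‖∑ γ ∈ R, a γ - (ν 𝓕).toReal⁻¹ • ∫ x, φ x ∂ν‖ ≤ R.card * ε :=
        norm_sum_sub_smul_integral_le h𝓕 hφ h0 htop R hR a hosc
    _ = ε * R.card := mul_comm _ _
    _ ≤ ε * ((ν B).toReal / (ν 𝓕).toReal) :=
        mul_le_mul_of_nonneg_left (card_le_measureReal_div h𝓕 h0 htop R hB hBtop) hε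

/-- `tsum` form of the packaged estimate, for sample values `a` vanishing off `R`:
`‖Σ'_{γ ∈ Γ} a(γ) − ν(𝓕)⁻¹ ∫ φ dν‖ ≤ ε · ν(B) / ν(𝓕)`.
[cite: Weil1965, Chap. I n° 12, proof of Lemme 5 (pp. 21–22)] -/
theorem norm_tsum_sub_smul_integral_le_of_smul_subset (h𝓕 : IsFundamentalDomain Γ 𝓕 ν)
    (hφ : Integrable φ ν) (h0 : ν 𝓕 ≠ 0) (htop : ν 𝓕 ≠ ∞) (R : Finset Γ)
    (hR : ∀ γ ∉ R, ∀ u ∈ 𝓕, φ (γ • u) = 0) {a : Γ → V} (ha : ∀ γ ∉ R, a γ = 0) {ε : ℝ}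
    (hε : 0 ≤ ε) (hosc : ∀ γ ∈ R, ∀ u ∈ 𝓕, ‖a γ - φ (γ • u)‖ ≤ ε) {B : Set α}
    (hB : ∀ γ ∈ R, γ • 𝓕 ⊆ B) (hBtop : ν B ≠ ∞) :
    ‖∑' γ, a γ - (ν 𝓕).toReal⁻¹ • ∫ x, φ x ∂ν‖ ≤ ε * ((ν B).toReal / (ν 𝓕).toReal) := by
  rw [tsum_eq_sum ha]
  exact norm_sum_sub_smul_integral_le_of_smul_subset h𝓕 hφ h0 htop R hR a hε hosc hB hBtop

/-! ## §6 Groups: left translation by a subgroup -/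

section Subgroup

variable {G : Type*} [Group G] [MeasurableSpace G] [MeasurableMul G] {μ : Measure G}
  [μ.IsMulLeftInvariant] (Λ : Subgroup G) [Countable Λ]

omit [Countable Λ] in
/-- Left translation by the elements of a subgroup is a measurable action. [cite: Weil1965, Chap. I n° 12, proof of Lemme 5 (pp. 21–22)] -/
theorem measurableConstSMul_subgroup : MeasurableConstSMul Λ G :=
  ⟨fun γ => measurable_const_mul (γ : G)⟩

omit [Countable Λ] in
/-- A left-invariant measure is invariant under left translation by a subgroup. [cite: Weil1965, Chap. I n° 12, proof of Lemme 5 (pp. 21–22)] -/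
theorem smulInvariantMeasure_subgroup : SMulInvariantMeasure Λ G μ :=
  ⟨fun γ s _hs => by
    rw [show (fun x : G => γ • x) ⁻¹' s = (fun x : G => (γ : G) * x) ⁻¹' s from rfl,
      measure_preimage_mul]⟩

/-- **LATTICE SUM VERSUS INTEGRAL, group form.** Let `μ` be a left-invariant measure on a group `G`,
`Λ ≤ G` a countable subgroup with a fundamental domain `𝓕` (for left translation) of finite
non-zero measure, `φ : G → V` integrable with `φ(γ u) = 0` for `γ ∉ R`, `u ∈ 𝓕`, and suppose
`‖φ(γ) − φ(γ u)‖ ≤ ε` for `γ ∈ R`, `u ∈ 𝓕` (oscillation of `φ` over the cells `γ 𝓕`), with the cells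
`γ 𝓕`, `γ ∈ R`, inside a set `B` of finite measure. Then
`‖Σ_{γ ∈ R} φ(γ) − μ(𝓕)⁻¹ ∫_G φ dμ‖ ≤ ε · μ(B) / μ(𝓕)`.
[cite: Weil1965, Chap. I n° 12, proof of Lemme 5 (pp. 21–22)] -/
theorem norm_sum_sub_smul_integral_le_of_mul_subset {𝓕 : Set G} {φ : G → V}
    (h𝓕 : IsFundamentalDomain Λ 𝓕 μ) (hφ : Integrable φ μ) (h0 : μ 𝓕 ≠ 0) (htop : μ 𝓕 ≠ ∞)
    (R : Finset Λ) (hR : ∀ γ ∉ R, ∀ u ∈ 𝓕, φ ((γ : G) * u) = 0) {ε : ℝ} (hε : 0 ≤ ε)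
    (hosc : ∀ γ ∈ R, ∀ u ∈ 𝓕, ‖φ γ - φ ((γ : G) * u)‖ ≤ ε) {B : Set G}
    (hB : ∀ γ ∈ R, (γ : G) • 𝓕 ⊆ B) (hBtop : μ B ≠ ∞) :
    ‖∑ γ ∈ R, φ γ - (μ 𝓕).toReal⁻¹ • ∫ x, φ x ∂μ‖ ≤ ε * ((μ B).toReal / (μ 𝓕).toReal) := by
  haveI := measurableConstSMul_subgroup Λ
  haveI : SMulInvariantMeasure Λ G μ := smulInvariantMeasure_subgroup Λ
  exact norm_sum_sub_smul_integral_le_of_smul_subset h𝓕 hφ h0 htop R hR (fun γ => φ γ) hε hosc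
    hB hBtop

/-- `tsum` form of the group estimate: if `φ(γ) = 0` for `γ ∈ Λ ∖ R` as well, then
`‖Σ'_{γ ∈ Λ} φ(γ) − μ(𝓕)⁻¹ ∫_G φ dμ‖ ≤ ε · μ(B) / μ(𝓕)`.
[cite: Weil1965, Chap. I n° 12, proof of Lemme 5 (pp. 21–22)] -/
theorem norm_tsum_sub_smul_integral_le_of_mul_subset {𝓕 : Set G} {φ : G → V}
    (h𝓕 : IsFundamentalDomain Λ 𝓕 μ) (hφ : Integrable φ μ) (h0 : μ 𝓕 ≠ 0) (htop : μ 𝓕 ≠ ∞)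
    (R : Finset Λ) (hR : ∀ γ ∉ R, ∀ u ∈ 𝓕, φ ((γ : G) * u) = 0) (hR' : ∀ γ ∉ R, φ γ = 0)
    {ε : ℝ} (hε : 0 ≤ ε) (hosc : ∀ γ ∈ R, ∀ u ∈ 𝓕, ‖φ γ - φ ((γ : G) * u)‖ ≤ ε) {B : Set G}
    (hB : ∀ γ ∈ R, (γ : G) • 𝓕 ⊆ B) (hBtop : μ B ≠ ∞) :
    ‖∑' γ : Λ, φ γ - (μ 𝓕).toReal⁻¹ • ∫ x, φ x ∂μ‖ ≤ ε * ((μ B).toReal / (μ 𝓕).toReal) := by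
  rw [tsum_eq_sum (s := R) (fun γ hγ => hR' γ hγ)]
  exact norm_sum_sub_smul_integral_le_of_mul_subset Λ h𝓕 hφ h0 htop R hR hε hosc hB hBtop

/-- The exact identity in the group form:
`Σ_{γ ∈ R} φ(γ) − μ(𝓕)⁻¹ ∫_G φ dμ = μ(𝓕)⁻¹ Σ_{γ ∈ R} ∫_𝓕 (φ(γ) − φ(γ u)) dμ(u)`.
[cite: Weil1965, Chap. I n° 12, proof of Lemme 5 (pp. 21–22)] -/
theorem sum_sub_smul_integral_eq_of_subgroup {𝓕 : Set G} {φ : G → V}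
    (h𝓕 : IsFundamentalDomain Λ 𝓕 μ) (hφ : Integrable φ μ) (h0 : μ 𝓕 ≠ 0) (htop : μ 𝓕 ≠ ∞)
    (R : Finset Λ) (hR : ∀ γ ∉ R, ∀ u ∈ 𝓕, φ ((γ : G) * u) = 0) :
    ∑ γ ∈ R, φ γ - (μ 𝓕).toReal⁻¹ • ∫ x, φ x ∂μ =
      (μ 𝓕).toReal⁻¹ • ∑ γ ∈ R, ∫ u in 𝓕, (φ γ - φ ((γ : G) * u)) ∂μ := by
  haveI := measurableConstSMul_subgroup Λ
  haveI : SMulInvariantMeasure Λ G μ := smulInvariantMeasure_subgroup Λ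
  exact sum_sub_smul_integral_eq h𝓕 hφ h0 htop R hR (fun γ => φ γ)

end Subgroup

end Literature.MeasureTheory.Group
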